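import Mathlib
import Literature.AlgebraicGeometry.Resolution.CobordantGame
import Literature.AlgebraicGeometry.Resolution.CobordantChartCoefficients
import Literature.AlgebraicGeometry.Resolution.CobordantTupleGame
import Literature.AlgebraicGeometry.Resolution.FormalCoordinateChange
import Summits.ResolutionOfSingularities.ResolutionOfSingularities.Theorems.WeightedInvariantLocalWeightedDropMonicPointBlowupSlot
import Summits.ResolutionOfSingularities.ResolutionOfSingularities.Theorems.WeightedInvariantLocalWeightedDropWildPurePowerSteps
import Summits.ResolutionOfSingularities.ResolutionOfSingularities.Theorems.WeightedInvariantLocalWeightedDropWildPurePowerUnaryExit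

/-!
# `WeightedInvariant.LocalWeightedDrop`, line `hasse-ridge-face-selection`: the DESCENT LIFT for the purely inseparable
# surface forms, SECOND VERSION — `p^e`-th power exit and one slot per exceptional point

Crux item stmt-ResolutionOfSingularities-8899 `LocalWeightedDrop` (route `ResolutionOfSingularities/WeightedInvariant`),
serving the door `WeightedConstruction` stmt-ResolutionOfSingularities-0571.  [OURS · L1 W4.3, chain w43, stub worker 1
(gen 3).  Not a statement of any manuscript.]

The first lift `WildPurePower.purePower_won_of_descent` (same directory, `…WildPurePowerDescent`) asks the descent datum
to serve EVERY position `A₀` with `ord A₀ > q = p^e`, including the `q`-th powers `A₀ = χ^q`: but `y^q + χ^q` is never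
terminal and its point-blow-up successors re-centre to positions of the same kind, so no well-founded measure can serve
them — that datum does not exist.  The game wins these germs differently: `y^q + χ^q` re-centres to `y^q`
(`won_purePower_recentre_iff`), and `y^q` alone is won by ONE cobordant move with weight only on `y`
(`won_X_pow_last`: at every exceptional point the saturated transform `(c_y + y')^q`, `c_y ≠ 0`, is a unit).
`purePower_won_of_descent₂` is the corrected lift: (a) cover, step and successor clauses only concern positions that are
NOT `q`-th powers (`∀ χ, χ(0) = 0 → A ≠ χ^q`), and a `q`-th power reached after the free moves is an exit;
(b) at each exceptional point `c ≠ 0` of the point blow-up the datum may CHOOSE the live slot `i₀` whose slice it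
serves (stub worker 2's `won_monic_of_pointBlowup_slot`): the saturated successor is a unit times a coordinate change of
the cylinder over the slice at any live slot, so one slot per point suffices — this is what lets a measure be read in the
coordinates of ONE chart per point (Hauser–Perlega, PRIMS 60 (2024) §6, normalise every blown-up point to the origin
of the `x`-chart).  `wildPurelyInseparableReductionWon_of_descent₂`: S3πM `stub_wildPurelyInseparableReductionWon`
VERBATIM from such a datum.
-/

set_option linter.dupNamespace false -- mandated namespace of this single-conjunct summit

namespace Summit.ResolutionOfSingularities.ResolutionOfSingularities.Theorems

open Literature.AlgebraicGeometry.Resolution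

namespace WildPurePower

open MvPowerSeries WildTerminal Literature.AlgebraicGeometry.Resolution.CobordantGame

variable {k : Type} [Field k]

/-! ### The `q`-th power exit -/

/-- `y^q` ALONE IS WON IN ONE MOVE (every field, every `q`, every number of variables): the cobordant move with
weight `1` on `y` and `0` elsewhere has no singular successor — at an exceptional point `c` (necessarily `c_y ≠ 0`) the
saturated transform is `(c_y + y')^q`, a unit. -/
theorem won_X_pow_last (m q : ℕ) :
    CobordantGame.Won k (m + 1) ((X (Fin.last m) : MvPowerSeries (Fin (m + 1)) k) ^ q) := by
  classical
  refine Won.move X (fun i => if i = Fin.last m then 1 else 0)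
    ⟨fun i => constantCoeff_X i, (TangentConeCut.isMove_X_one (Nat.succ_pos m)).2.1,
      ⟨Fin.last m, by simp⟩⟩ fun g hg => ?_
  exfalso
  obtain ⟨pt, a, ⟨l, hl, hptl⟩, hfac, hndvd, hsing⟩ := hg
  have hl' : l = Fin.last m := by
    by_contra h
    simp [h] at hl
  subst hl'
  have hself : subst (X : Fin (m + 1) → MvPowerSeries (Fin (m + 1)) k)
      ((X (Fin.last m) : MvPowerSeries (Fin (m + 1)) k) ^ q) = X (Fin.last m) ^ q := by
    rw [subst_self]; rfl
  rw [hself] at hfac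
  have hcc : HasSubst (cruxChart k (fun i : Fin (m + 1) => if i = Fin.last m then 1 else 0) pt) :=
    hasSubst_of_constantCoeff_zero fun i => by
      unfold cruxChart
      by_cases hi : i = Fin.last m
      · subst hi; simp [constantCoeff_X]
      · simp [hi, constantCoeff_X]
  have hlast : cruxChart k (fun i : Fin (m + 1) => if i = Fin.last m then 1 else 0) pt (Fin.last m) =
      X 0 * (C (pt (Fin.last m)) + X (Fin.last m).succ) := by
    simp [cruxChart]
  rw [subst_pow hcc, subst_X hcc, hlast, mul_pow] at hfac
  set g₀ : MvPowerSeries (Fin (m + 1 + 1)) k := (C (pt (Fin.last m)) + X (Fin.last m).succ) ^ q with hg₀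
  have hg₀0 : constantCoeff g₀ = pt (Fin.last m) ^ q := by
    rw [hg₀, map_pow, map_add, constantCoeff_C, constantCoeff_X, add_zero]
  have hndvd₀ : ¬ X 0 ∣ g₀ := fun h => by
    obtain ⟨r, hr⟩ := h
    have := hg₀0
    rw [hr, map_mul, constantCoeff_X, zero_mul] at this
    exact hptl (pow_eq_zero_iff' |>.mp this.symm).1
  obtain ⟨-, hgg⟩ := X_pow_mul_eq_X_pow_mul 0 hfac hndvd₀ hndvd
  have h00 := hsing.1
  rw [← hgg, hg₀0] at h00
  exact hptl (pow_eq_zero_iff' |>.mp h00).1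

/-- THE `q`-TH POWER EXIT (characteristic `p`, `q = p^e`): `y^q + χ^q` with `χ(0) = 0` is won — re-centre to `y^q`
(`won_purePower_recentre_iff`) and play `won_X_pow_last`. -/
theorem won_purePower_of_qthPower (p : ℕ) (hp : p.Prime) [CharP k p] {m : ℕ} (e : ℕ)
    (χ : MvPowerSeries (Fin m) k) (hχ : constantCoeff χ = 0) :
    CobordantGame.Won k (m + 1) (X (Fin.last m) ^ (p ^ e) + rename (Fin.succAboveEmb (Fin.last m)) (χ ^ (p ^ e))) := by
  haveI := Fact.mk hp
  have hneg : constantCoeff (-χ) = 0 := by rw [map_neg, hχ, neg_zero]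
  have h := won_purePower_recentre_iff p hp e (-χ) hneg (χ ^ (p ^ e))
  have hsum : χ ^ (p ^ e) + (-χ) ^ (p ^ e) = 0 := by
    haveI : CharP (MvPowerSeries (Fin m) k) p := Literature.RingTheory.TwoVariableSeries.charP_mvPowerSeries (Fin m) p
    rw [neg_pow, neg_one_pow_char_pow (MvPowerSeries (Fin m) k) p e, neg_one_mul, add_neg_cancel]
  rw [hsum, map_zero, add_zero] at h
  exact h.mp (won_X_pow_last m (p ^ e))

/-! ### The point step with one slot per exceptional point -/

/-- THE POINT STEP for `y^q + A₀(x₁,x₂)` (`ord A₀ > q ≥ 1`), SLOT CHOSEN BY THE CALLER: if at every exceptional point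
`c ≠ 0` of the point blow-up (`A₀ ∘ chart(c) = s^{q+1} B₀`) there is SOME live slot `i₀` (`c_{i₀} ≠ 0`) whose singular
successor `y^q + (s · B₀)|_{y_{i₀} = 0}` is won, then `y^q + A₀` is won (`won_monic_of_pointBlowup_slot` on the collapsed
tuple `(A₀, 0, …, 0)`). -/
theorem won_purePower_of_pointStep_slot (p : ℕ) (hp : p.Prime) (k : Type) [Field k] [CharP k p] {q : ℕ} (hq : 0 < q)
    (A₀ : MvPowerSeries (Fin 2) k) (hA₀ : (q : ℕ∞) < A₀.order)
    (hsucc : ∀ (c : Fin 2 → k), (∃ i, c i ≠ 0) → ∀ B₀ : MvPowerSeries (Fin (2 + 1)) k,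
      MvPowerSeries.subst (CobordantChart.chart (fun _ : Fin 2 => 1) c) A₀ = MvPowerSeries.X 0 ^ (q + 1) * B₀ →
      ∃ i₀ : Fin 2, c i₀ ≠ 0 ∧
        (CobordantGame.IsSingular k (MvPowerSeries.X (Fin.last 2) ^ q +
          MvPowerSeries.rename (Fin.succAboveEmb (Fin.last 2)) (TupleGame.slice i₀ (MvPowerSeries.X 0 * B₀))) →
        CobordantGame.Won k (2 + 1) (MvPowerSeries.X (Fin.last 2) ^ q +
          MvPowerSeries.rename (Fin.succAboveEmb (Fin.last 2)) (TupleGame.slice i₀ (MvPowerSeries.X 0 * B₀))))) :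
    CobordantGame.Won k (2 + 1) (MvPowerSeries.X (Fin.last 2) ^ q +
      MvPowerSeries.rename (Fin.succAboveEmb (Fin.last 2)) A₀) := by
  classical
  set T : Fin q → MvPowerSeries (Fin 2) k := fun j => if (j : ℕ) = 0 then A₀ else 0 with hT
  have hT0 : T ⟨0, hq⟩ = A₀ := if_pos rfl
  have hTne : ∀ j : Fin q, (j : ℕ) ≠ 0 → T j = 0 := fun j hj => if_neg hj
  have h := won_monic_of_pointBlowup_slot p hp k 2 q hq T (polyhedron_of_vanish hq T hTne (by rw [hT0]; exact hA₀)) ?_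
  · rw [monicForm_eq_of_vanish hq T hTne, hT0] at h
    exact h
  · intro c hc Bv hBv
    have hB0 := hBv ⟨0, hq⟩
    rw [hT0, show q - ((⟨0, hq⟩ : Fin q) : ℕ) + 1 = q + 1 by simp] at hB0
    obtain ⟨i₀, hci₀, hwin⟩ := hsucc c hc (Bv ⟨0, hq⟩) hB0
    refine ⟨i₀, hci₀, fun hS => ?_⟩
    rw [monicForm_eq_of_vanish hq _ (fun j hj => pointCoeff_vanish c i₀ T hTne Bv hBv j hj)] at hS ⊢
    exact hwin hS

/-! ### The corrected descent lift -/

/-- THE DESCENT LIFT FOR `y^q + A₀(x₁,x₂)`, SECOND VERSION (`q = p^e`, `k` algebraically closed of characteristic `p`).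
DATA: states with a coefficient `germ s ∈ k[[x₁,x₂]]` and an ordinal measure `μ`.  STEP PROPERTY, demanded only at states
whose coefficient is a position (`ord > q`) and NOT a `q`-th power: after a free plane change `θ` and cleaning `φ`
(`A₁ = germ s ∘ θ + φ^q`, again a position), EITHER `A₁` is a `q`-th power, OR `A₁` is terminal (monomial / small
residual), OR at every exceptional point `c ≠ 0` of the point blow-up (`A₁ ∘ chart(c) = s^{q+1} B₀`) there is a live slot
`i₀` such that every re-centred successor `T + φ'^q` (`T = (s B₀)|_{y_{i₀}=0}`) which is a position and not a `q`-th power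
is the coefficient of a state of smaller measure.  CONCLUSION: every such state's germ `y^q + germ s` is won. -/
theorem purePower_won_of_descent₂ (p : ℕ) (hp : p.Prime) (k : Type) [Field k] [CharP k p] [IsAlgClosed k] (e : ℕ)
    (hord : ∀ g : MvPowerSeries (Fin 3) k, CobordantGame.IsSingular k g → g.order < (p ^ e : ℕ) →
      CobordantGame.Won k 3 g)
    (haxis : ∀ g : MvPowerSeries (Fin 3) k, CobordantGame.IsSingular k g → g.order = (p ^ e : ℕ) →
      (∃ c : Fin 3 → k, c ≠ 0 ∧ ∀ v : Fin 3 → k,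
        CobordantChart.initEval (fun _ : Fin 3 => 1) (v + c) (p ^ e) g =
          CobordantChart.initEval (fun _ : Fin 3 => 1) v (p ^ e) g) →
      (∀ c₁ c₂ : Fin 3 → k,
        (∀ v : Fin 3 → k, CobordantChart.initEval (fun _ : Fin 3 => 1) (v + c₁) (p ^ e) g =
          CobordantChart.initEval (fun _ : Fin 3 => 1) v (p ^ e) g) →
        (∀ v : Fin 3 → k, CobordantChart.initEval (fun _ : Fin 3 => 1) (v + c₂) (p ^ e) g =
          CobordantChart.initEval (fun _ : Fin 3 => 1) v (p ^ e) g) →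
        ∃ α β : k, (α ≠ 0 ∨ β ≠ 0) ∧ α • c₁ + β • c₂ = 0) →
      CobordantGame.Won k 3 g)
    (hterm : ∀ (A₀ : MvPowerSeries (Fin 2) k), ((p ^ e : ℕ) : ℕ∞) < A₀.order →
      ((∃ (r s : ℕ) (U : MvPowerSeries (Fin 2) k), constantCoeff U ≠ 0 ∧ ¬ (p ^ e ∣ r ∧ p ^ e ∣ s) ∧
          A₀ = X (0 : Fin 2) ^ r * X (1 : Fin 2) ^ s * U) ∨
        (∃ (i : Fin 2) (m : ℕ) (g : MvPowerSeries (Fin 2) k), 0 < m ∧ 0 < g.order ∧ g.order < (p ^ e : ℕ) ∧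
          A₀ = X i ^ (p ^ e * m) * g)) →
      CobordantGame.Won k 3 (X (Fin.last 2) ^ (p ^ e) + rename (Fin.succAboveEmb (Fin.last 2)) A₀))
    {S : Type*} (germ : S → MvPowerSeries (Fin 2) k) (μ : S → Ordinal.{0})
    (hstep : ∀ s : S, ((p ^ e : ℕ) : ℕ∞) < (germ s).order →
      (∀ χ : MvPowerSeries (Fin 2) k, constantCoeff χ = 0 → germ s ≠ χ ^ (p ^ e)) →
      ∃ (θ : Fin 2 → MvPowerSeries (Fin 2) k) (φ : MvPowerSeries (Fin 2) k),
        (∀ i, constantCoeff (θ i) = 0) ∧ IsUnit (FormalCoordChange.linMat θ).det ∧ constantCoeff φ = 0 ∧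
        ((p ^ e : ℕ) : ℕ∞) < (subst θ (germ s) + φ ^ (p ^ e)).order ∧
        ((∃ χ : MvPowerSeries (Fin 2) k, constantCoeff χ = 0 ∧ subst θ (germ s) + φ ^ (p ^ e) = χ ^ (p ^ e)) ∨
          ((∃ (r t : ℕ) (U : MvPowerSeries (Fin 2) k), constantCoeff U ≠ 0 ∧ ¬ (p ^ e ∣ r ∧ p ^ e ∣ t) ∧
              subst θ (germ s) + φ ^ (p ^ e) = X (0 : Fin 2) ^ r * X (1 : Fin 2) ^ t * U) ∨
            (∃ (i : Fin 2) (m : ℕ) (g : MvPowerSeries (Fin 2) k), 0 < m ∧ 0 < g.order ∧ g.order < (p ^ e : ℕ) ∧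
              subst θ (germ s) + φ ^ (p ^ e) = X i ^ (p ^ e * m) * g)) ∨
          (∀ (c : Fin 2 → k), (∃ i, c i ≠ 0) → ∀ B₀ : MvPowerSeries (Fin (2 + 1)) k,
            subst (CobordantChart.chart (fun _ : Fin 2 => 1) c) (subst θ (germ s) + φ ^ (p ^ e)) =
              X 0 ^ (p ^ e + 1) * B₀ →
            ∃ i₀ : Fin 2, c i₀ ≠ 0 ∧ ∀ φ' : MvPowerSeries (Fin 2) k, constantCoeff φ' = 0 →
              ((p ^ e : ℕ) : ℕ∞) < (TupleGame.slice i₀ (X 0 * B₀) + φ' ^ (p ^ e)).order →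
              (∀ χ : MvPowerSeries (Fin 2) k, constantCoeff χ = 0 →
                TupleGame.slice i₀ (X 0 * B₀) + φ' ^ (p ^ e) ≠ χ ^ (p ^ e)) →
              ∃ s' : S, germ s' = TupleGame.slice i₀ (X 0 * B₀) + φ' ^ (p ^ e) ∧ μ s' < μ s))) :
    ∀ s : S, ((p ^ e : ℕ) : ℕ∞) < (germ s).order →
      (∀ χ : MvPowerSeries (Fin 2) k, constantCoeff χ = 0 → germ s ≠ χ ^ (p ^ e)) →
      CobordantGame.Won k (2 + 1) (X (Fin.last 2) ^ (p ^ e) + rename (Fin.succAboveEmb (Fin.last 2)) (germ s)) := by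
  classical
  set q := p ^ e with hq
  have hq0 : 0 < q := pow_pos hp.pos e
  suffices key : ∀ (α : Ordinal.{0}) (s : S), μ s = α → ((q : ℕ) : ℕ∞) < (germ s).order →
      (∀ χ : MvPowerSeries (Fin 2) k, constantCoeff χ = 0 → germ s ≠ χ ^ q) →
      Won k (2 + 1) (X (Fin.last 2) ^ q + rename (Fin.succAboveEmb (Fin.last 2)) (germ s)) from
    fun s hs hns => key _ s rfl hs hns
  intro α
  induction α using WellFoundedLT.induction with
  | ind α ih =>
  intro s hα hs hns
  obtain ⟨θ, φ, hθ0, hθdet, hφ0, hA₁, hbr⟩ := hstep s hs hns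
  -- the free moves: plane change, then cleaning
  rw [← won_purePower_substX_iff θ hθ0 hθdet, ← won_purePower_recentre_iff p hp e φ hφ0]
  set A₁ := subst θ (germ s) + φ ^ q with hA₁def
  rcases hbr with ⟨χ, hχ0, hχ⟩ | hT | hpt
  · rw [hχ]
    exact won_purePower_of_qthPower p hp e χ hχ0
  · exact hterm A₁ hA₁ hT
  · -- the point blow-up, one slot per exceptional point; every singular successor is an exit or a smaller state
    refine won_purePower_of_pointStep_slot p hp k hq0 A₁ hA₁ fun c hc B₀ hB => ?_
    obtain ⟨i₀, hci₀, hsl⟩ := hpt c hc B₀ hB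
    refine ⟨i₀, hci₀, fun hSs => ?_⟩
    set T := TupleGame.slice i₀ (X 0 * B₀) with hTdef
    by_cases hTlt : T.order < (q : ℕ)
    · exact hord _ hSs (lt_of_le_of_lt (order_X_pow_add_rename_le hq0 T) hTlt)
    rw [not_lt] at hTlt
    have hSq : ((X (Fin.last 2) : MvPowerSeries (Fin (2 + 1)) k) ^ q +
        rename (Fin.succAboveEmb (Fin.last 2)) T).order = q :=
      order_X_pow_add_rename_eq hq0 T hTlt
    by_cases hwide : ∃ c₁ c₂ : Fin 3 → k, (∀ α β : k, α • c₁ + β • c₂ = 0 → α = 0 ∧ β = 0) ∧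
        (∀ v : Fin 3 → k, CobordantChart.initEval (fun _ : Fin 3 => 1) (v + c₁) q
          ((X (Fin.last 2) : MvPowerSeries (Fin (2 + 1)) k) ^ q + rename (Fin.succAboveEmb (Fin.last 2)) T) =
          CobordantChart.initEval (fun _ : Fin 3 => 1) v q
          ((X (Fin.last 2) : MvPowerSeries (Fin (2 + 1)) k) ^ q + rename (Fin.succAboveEmb (Fin.last 2)) T)) ∧
        (∀ v : Fin 3 → k, CobordantChart.initEval (fun _ : Fin 3 => 1) (v + c₂) q
          ((X (Fin.last 2) : MvPowerSeries (Fin (2 + 1)) k) ^ q + rename (Fin.succAboveEmb (Fin.last 2)) T) =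
          CobordantChart.initEval (fun _ : Fin 3 => 1) v q
          ((X (Fin.last 2) : MvPowerSeries (Fin (2 + 1)) k) ^ q + rename (Fin.succAboveEmb (Fin.last 2)) T))
    · -- wide apex: re-centre to a position; a `q`-th power is an exit, anything else is a smaller state
      obtain ⟨c₁, c₂, hind, h₁, h₂⟩ := hwide
      obtain ⟨φ', hφ'0, hφ'ord, hiff⟩ := exists_recentre_of_wide p hp k e T hTlt c₁ c₂ hind h₁ h₂
      rw [hiff]
      by_cases hQ : ∃ χ : MvPowerSeries (Fin 2) k, constantCoeff χ = 0 ∧ T + φ' ^ q = χ ^ q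
      · obtain ⟨χ, hχ0, hχ⟩ := hQ
        rw [hχ]
        exact won_purePower_of_qthPower p hp e χ hχ0
      · push Not at hQ
        obtain ⟨s', hs', hμ⟩ := hsl φ' hφ'0 hφ'ord hQ
        rw [← hs']
        exact ih (μ s') (hα ▸ hμ) s' rfl (by rw [hs']; exact hφ'ord) (by rw [hs']; exact hQ)
    · -- not wide: apex-free or axis
      exact won_of_order_eq_of_not_wide p hp k hord haxis _ hSs hSq hwide

/-- S3πM FROM A DESCENT DATUM (second version): the registered stub `stub_wildPurelyInseparableReductionWon` (skeleton v28)
VERBATIM, as soon as for every algebraically closed field of characteristic `p` and every `q = p^e > 2` (under its side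
hypotheses) there are states, coefficients and a measure with the step property of `purePower_won_of_descent₂` covering
every position that is not a `q`-th power (the `q`-th powers are won directly, `won_purePower_of_qthPower`). -/
theorem wildPurelyInseparableReductionWon_of_descent₂
    (hdesc : ∀ (p : ℕ), p.Prime → ∀ (k : Type) [Field k] [CharP k p] [IsAlgClosed k] (e : ℕ), 2 < p ^ e →
      (∀ m : ℕ, m < 3 → ∀ g : MvPowerSeries (Fin m) k, CobordantGame.IsSingular k g → CobordantGame.Won k m g) →
      (∀ g : MvPowerSeries (Fin 3) k, CobordantGame.IsSingular k g → g.order < (p ^ e : ℕ) → CobordantGame.Won k 3 g) →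
      (∀ g : MvPowerSeries (Fin 3) k, CobordantGame.IsSingular k g → g.order = (p ^ e : ℕ) →
        (∃ c : Fin 3 → k, c ≠ 0 ∧ ∀ v : Fin 3 → k,
          CobordantChart.initEval (fun _ : Fin 3 => 1) (v + c) (p ^ e) g =
            CobordantChart.initEval (fun _ : Fin 3 => 1) v (p ^ e) g) →
        (∀ c₁ c₂ : Fin 3 → k,
          (∀ v : Fin 3 → k, CobordantChart.initEval (fun _ : Fin 3 => 1) (v + c₁) (p ^ e) g =
            CobordantChart.initEval (fun _ : Fin 3 => 1) v (p ^ e) g) →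
          (∀ v : Fin 3 → k, CobordantChart.initEval (fun _ : Fin 3 => 1) (v + c₂) (p ^ e) g =
            CobordantChart.initEval (fun _ : Fin 3 => 1) v (p ^ e) g) →
          ∃ α β : k, (α ≠ 0 ∨ β ≠ 0) ∧ α • c₁ + β • c₂ = 0) →
        CobordantGame.Won k 3 g) →
      ∃ (S : Type) (germ : S → MvPowerSeries (Fin 2) k) (μ : S → Ordinal.{0}),
        (∀ A₀ : MvPowerSeries (Fin 2) k, ((p ^ e : ℕ) : ℕ∞) < A₀.order →
          (∀ χ : MvPowerSeries (Fin 2) k, constantCoeff χ = 0 → A₀ ≠ χ ^ (p ^ e)) → ∃ s, germ s = A₀) ∧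
        (∀ s : S, ((p ^ e : ℕ) : ℕ∞) < (germ s).order →
          (∀ χ : MvPowerSeries (Fin 2) k, constantCoeff χ = 0 → germ s ≠ χ ^ (p ^ e)) →
          ∃ (θ : Fin 2 → MvPowerSeries (Fin 2) k) (φ : MvPowerSeries (Fin 2) k),
            (∀ i, constantCoeff (θ i) = 0) ∧ IsUnit (FormalCoordChange.linMat θ).det ∧ constantCoeff φ = 0 ∧
            ((p ^ e : ℕ) : ℕ∞) < (subst θ (germ s) + φ ^ (p ^ e)).order ∧
            ((∃ χ : MvPowerSeries (Fin 2) k, constantCoeff χ = 0 ∧ subst θ (germ s) + φ ^ (p ^ e) = χ ^ (p ^ e)) ∨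
              ((∃ (r t : ℕ) (U : MvPowerSeries (Fin 2) k), constantCoeff U ≠ 0 ∧ ¬ (p ^ e ∣ r ∧ p ^ e ∣ t) ∧
                  subst θ (germ s) + φ ^ (p ^ e) = X (0 : Fin 2) ^ r * X (1 : Fin 2) ^ t * U) ∨
                (∃ (i : Fin 2) (m : ℕ) (g : MvPowerSeries (Fin 2) k), 0 < m ∧ 0 < g.order ∧ g.order < (p ^ e : ℕ) ∧
                  subst θ (germ s) + φ ^ (p ^ e) = X i ^ (p ^ e * m) * g)) ∨
              (∀ (c : Fin 2 → k), (∃ i, c i ≠ 0) → ∀ B₀ : MvPowerSeries (Fin (2 + 1)) k,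
                subst (CobordantChart.chart (fun _ : Fin 2 => 1) c) (subst θ (germ s) + φ ^ (p ^ e)) =
                  X 0 ^ (p ^ e + 1) * B₀ →
                ∃ i₀ : Fin 2, c i₀ ≠ 0 ∧ ∀ φ' : MvPowerSeries (Fin 2) k, constantCoeff φ' = 0 →
                  ((p ^ e : ℕ) : ℕ∞) < (TupleGame.slice i₀ (X 0 * B₀) + φ' ^ (p ^ e)).order →
                  (∀ χ : MvPowerSeries (Fin 2) k, constantCoeff χ = 0 →
                    TupleGame.slice i₀ (X 0 * B₀) + φ' ^ (p ^ e) ≠ χ ^ (p ^ e)) →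
                  ∃ s' : S, germ s' = TupleGame.slice i₀ (X 0 * B₀) + φ' ^ (p ^ e) ∧ μ s' < μ s)))) :
    ∀ (p : ℕ), p.Prime → ∀ (k : Type) [Field k] [CharP k p] [IsAlgClosed k],
      (∀ m : ℕ, m < 3 → ∀ g : MvPowerSeries (Fin m) k,
        CobordantGame.IsSingular k g → CobordantGame.Won k m g) →
      ∀ (d : ℕ), (∃ e : ℕ, d = p ^ e) → 2 < d →
      (∀ g : MvPowerSeries (Fin 3) k, CobordantGame.IsSingular k g → g.order < d →
        CobordantGame.Won k 3 g) →
      (∀ g : MvPowerSeries (Fin 3) k, CobordantGame.IsSingular k g → g.order = d →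
        (∃ c : Fin 3 → k, c ≠ 0 ∧ ∀ v : Fin 3 → k,
          CobordantChart.initEval (fun _ : Fin 3 => 1) (v + c) d g =
            CobordantChart.initEval (fun _ : Fin 3 => 1) v d g) →
        (∀ c₁ c₂ : Fin 3 → k,
          (∀ v : Fin 3 → k, CobordantChart.initEval (fun _ : Fin 3 => 1) (v + c₁) d g =
            CobordantChart.initEval (fun _ : Fin 3 => 1) v d g) →
          (∀ v : Fin 3 → k, CobordantChart.initEval (fun _ : Fin 3 => 1) (v + c₂) d g =
            CobordantChart.initEval (fun _ : Fin 3 => 1) v d g) →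
          ∃ α β : k, (α ≠ 0 ∨ β ≠ 0) ∧ α • c₁ + β • c₂ = 0) →
        CobordantGame.Won k 3 g) →
      (∀ (A₀ : MvPowerSeries (Fin 2) k), (d : ℕ∞) < A₀.order →
        ((∃ (r s : ℕ) (U : MvPowerSeries (Fin 2) k), MvPowerSeries.constantCoeff U ≠ 0 ∧ ¬ (d ∣ r ∧ d ∣ s) ∧
            A₀ = MvPowerSeries.X (0 : Fin 2) ^ r * MvPowerSeries.X (1 : Fin 2) ^ s * U) ∨
          (∃ (i : Fin 2) (m : ℕ) (g : MvPowerSeries (Fin 2) k), 0 < m ∧ 0 < g.order ∧ g.order < d ∧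
            A₀ = MvPowerSeries.X i ^ (d * m) * g)) →
        CobordantGame.Won k 3 (MvPowerSeries.X (Fin.last 2) ^ d +
          MvPowerSeries.rename (Fin.succAboveEmb (Fin.last 2)) A₀)) →
      ∀ (A₀ : MvPowerSeries (Fin 2) k), (d : ℕ∞) < A₀.order →
        CobordantGame.Won k 3 (MvPowerSeries.X (Fin.last 2) ^ d +
          MvPowerSeries.rename (Fin.succAboveEmb (Fin.last 2)) A₀) := by
  intro p hp k _ _ _ hlow d hpe h2d hord haxis hterm A₀ hA₀
  obtain ⟨e, rfl⟩ := hpe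
  by_cases hQ : ∃ χ : MvPowerSeries (Fin 2) k, constantCoeff χ = 0 ∧ A₀ = χ ^ (p ^ e)
  · obtain ⟨χ, hχ0, rfl⟩ := hQ
    exact won_purePower_of_qthPower p hp e χ hχ0
  push Not at hQ
  obtain ⟨S, germ, μ, hcover, hstep⟩ := hdesc p hp k e h2d hlow hord haxis
  obtain ⟨s, hs⟩ := hcover A₀ hA₀ hQ
  have h := purePower_won_of_descent₂ p hp k e hord haxis hterm germ μ hstep s (by rw [hs]; exact hA₀)
    (by rw [hs]; exact hQ)
  rw [hs] at h
  exact h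

end WildPurePower

end Summit.ResolutionOfSingularities.ResolutionOfSingularities.Theorems
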